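import Summits.CriticalPhenomena.PercolationContinuityZ3.Theorems.PercNearOneGluingNoHeavyLowerTailGZWheatstonePlus

/-!
# `NoHeavyLowerTail` (stmt-CriticalPhenomena-4575) — support file: the analytic core of the TRANSFER + MARSHALL–OLKIN method (cell level, skeleton-free)

Support file (`--supports stmt-CriticalPhenomena-4575`; no definitions, no sorries), prover `prim-ineq-prove-2` gen 16, memo
`run/shared/lean/prim/prim-ineq-prove-2/THEOREM-WPLUS.md` §2 (END) and §6 (THEOREM K⁺).
`GZWheatstonePlus.wplus_bridge_cov_le` / `GZWheatstonePlusFan.wplus_fan_cov_le` prove the logarithmic covariance bound for the Wheatstone skeleton with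
one hub-bearing gadget by the same five analytic steps; this file isolates those steps as ONE lemma over abstract reals, so that a future slot `(u,v)` of any
skeleton `K` (memo §6: THEOREM K⁺ for separating slots) needs only its polynomial IDENTITIES and its KEY certificate:
* data of the slot: `S = P(a~b off the slot)`, `C` = pivotality, the gadget's `θ_B ≥ w_B > 0` and Harris-correlated pattern law in Marshall–Olkin form
  (common shock `1 − q_X`, idiosyncratic marks `1 − q₁`, `1 − q₂`), so that `Cov_B = (1−q_X)q_X q₁q₂`;
* `Law₀` = the remainder `K'` with INDEPENDENT hubs `1−q₁, 1−q₂` at the slot ends: its `w₀ > 0` and its bound `h0 : Cov₀ ≤ w₀ log(S/w₀)` (THEOREM SP / W / …);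
* the mixture identities `m = q_X w₀`, `Cov = q_X Cov₀ + (1−q_X)q_X D` (`D = ΔA·ΔB`), and the correlation inequality `KEY : D ≤ w₀ + C q₁q₂`;
* the gadget's own bound `hL : Cov_B ≤ w_B log(θ_B/w_B)`.
Conclusion (`transfer_mo_cov_le`): `Cov ≤ (m + C w_B)·log((S + Cθ_B)/(m + C w_B))`, i.e. L-log for the composite whose cells are `θ = S + Cθ_B`, `w = m + C w_B`.
[this work — memo THEOREM-WPLUS.md]
-/

namespace Summit.CriticalPhenomena.PercolationContinuityZ3.Theorems

namespace GZTransferMO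

/-- **Marshall–Olkin mixture step** (memo §2 (MIX)–(END)): from the remainder's bound `h0`, the correlation inequality `KEY` and `log(1/q_X) ≥ 1 − q_X`,
the correlated-pair network satisfies `Cov − C·Cov_μ ≤ m log(S/m)` where `m = q_X w₀`, `Cov = q_X Cov₀ + (1−q_X)q_X D`, `Cov_μ = (1−q_X)q_X q₁q₂`. -/
theorem mo_mixture_cov_le {S C w₀ Cov₀ D q₁ q₂ qX : ℝ}
    (hS : 0 < S) (hw₀ : 0 < w₀) (hqX : 0 < qX) (hqX1 : qX ≤ 1)
    (h0 : Cov₀ ≤ w₀ * Real.log (S / w₀)) (KEY : D ≤ w₀ + C * q₁ * q₂) :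
    qX * Cov₀ + (1 - qX) * qX * D - C * ((1 - qX) * qX * (q₁ * q₂)) ≤ (qX * w₀) * Real.log (S / (qX * w₀)) := by
  have h1qX : 0 ≤ 1 - qX := by linarith
  have hlog : Real.log (S / (qX * w₀)) = Real.log (S / w₀) - Real.log qX := by
    rw [Real.log_div hS.ne' (mul_pos hqX hw₀).ne', Real.log_div hS.ne' hw₀.ne', Real.log_mul hqX.ne' hw₀.ne']
    ring
  have hlq : Real.log qX ≤ qX - 1 := Real.log_le_sub_one_of_pos hqX
  rw [hlog]
  have hqq : 0 ≤ (1 - qX) * qX := mul_nonneg h1qX hqX.le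
  have t1 : (1 - qX) * qX * D - C * ((1 - qX) * qX * (q₁ * q₂)) ≤ (1 - qX) * qX * w₀ := by
    have k := mul_le_mul_of_nonneg_left KEY hqq
    have e : (1 - qX) * qX * (w₀ + C * q₁ * q₂) = (1 - qX) * qX * w₀ + C * ((1 - qX) * qX * (q₁ * q₂)) := by ring
    linarith [k, e]
  have t2 : qX * Cov₀ ≤ qX * (w₀ * Real.log (S / w₀)) := mul_le_mul_of_nonneg_left h0 hqX.le
  have t3 : (1 - qX) * qX * w₀ ≤ qX * w₀ * (-Real.log qX) := by
    have k := mul_le_mul_of_nonneg_left (show 1 - qX ≤ -Real.log qX by linarith) (mul_nonneg hqX.le hw₀.le)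
    have e : qX * w₀ * (1 - qX) = (1 - qX) * qX * w₀ := by ring
    linarith [k, e]
  linarith [t1, t2, t3]

/-- **TRANSFER + MARSHALL–OLKIN bound** (memo §2 and §6 (K2), the skeleton-free core of THEOREM W⁺ / THEOREM K⁺): for a slot with `S > 0`, pivotality `C > 0`,
a gadget with `θ_B ≥ w_B > 0` satisfying L-log (`hL`, with `Cov_B = (1−q_X)q_Xq₁q₂` in Marshall–Olkin coordinates), a remainder `Law₀` with `w₀ > 0` satisfying the bound
(`h0`), the mixture data `m = q_Xw₀`, `Cov = q_XCov₀ + (1−q_X)q_X D` and the correlation inequality `KEY`, the composite with `θ = S + Cθ_B`, `w = m + C w_B` satisfies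
`Cov ≤ w log(θ/w)`. -/
theorem transfer_mo_cov_le {S C θB wB w₀ Cov₀ D q₁ q₂ qX m Cov θ w : ℝ}
    (hS : 0 < S) (hC : 0 < C) (hwB : 0 < wB) (hθB : wB ≤ θB) (hw₀ : 0 < w₀) (hqX : 0 < qX) (hqX1 : qX ≤ 1)
    (hL : (1 - qX) * qX * (q₁ * q₂) ≤ wB * Real.log (θB / wB))
    (h0 : Cov₀ ≤ w₀ * Real.log (S / w₀)) (KEY : D ≤ w₀ + C * q₁ * q₂)
    (hm : m = qX * w₀) (hCov : Cov = qX * Cov₀ + (1 - qX) * qX * D)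
    (hθ : θ = S + C * θB) (hw : w = m + C * wB) :
    Cov ≤ w * Real.log (θ / w) := by
  have hθB0 : 0 < θB := lt_of_lt_of_le hwB hθB
  have hmix := mo_mixture_cov_le (C := C) hS hw₀ hqX hqX1 h0 KEY
  have hm0 : 0 < m := by rw [hm]; positivity
  have hls := GZWheatstonePlus.logsum2 (m₁ := m) (m₂ := C * wB) (P₁ := S) (P₂ := C * θB) hm0 (by positivity) hS (by positivity)
  have e2 : C * θB / (C * wB) = θB / wB := by rw [mul_div_mul_left _ _ hC.ne']
  rw [e2] at hls
  have hcred : C * ((1 - qX) * qX * (q₁ * q₂)) ≤ C * wB * Real.log (θB / wB) := by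
    have := mul_le_mul_of_nonneg_left hL hC.le
    linarith
  rw [hCov, hθ, hw, hm]
  rw [hm] at hls
  linarith [hmix, hls, hcred]

/-- **Marshall–Olkin coordinates of a positively correlated pair of marks** (memo §2 (MO)): for a pattern law `(τ, α, β, ν)` (both / first only / second only / none)
with `ν > 0`, `α, β ≥ 0`, `τ + α + β + ν = 1` and Harris `αβ ≤ ντ`, the numbers `q₁ = ν/(ν+α)`, `q₂ = ν/(ν+β)`, `q_X = (ν+α)(ν+β)/ν` lie in `(0,1]` and reproduce the law:
`ν = q_Xq₁q₂`, `α = q_X(1−q₁)q₂`, `β = q_Xq₁(1−q₂)` (and then `ντ − αβ = (1−q_X)q_Xq₁q₂`). -/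
theorem mo_coordinates {τ α β ν : ℝ} (hα : 0 ≤ α) (hβ : 0 ≤ β) (hν : 0 < ν) (hsum : τ + α + β + ν = 1) (hH : α * β ≤ ν * τ) :
    0 < ν / (ν + α) ∧ ν / (ν + α) ≤ 1 ∧ 0 < ν / (ν + β) ∧ ν / (ν + β) ≤ 1 ∧ 0 < (ν + α) * (ν + β) / ν ∧ (ν + α) * (ν + β) / ν ≤ 1 ∧
      ν = (ν + α) * (ν + β) / ν * (ν / (ν + α)) * (ν / (ν + β)) ∧
      α = (ν + α) * (ν + β) / ν * (1 - ν / (ν + α)) * (ν / (ν + β)) ∧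
      β = (ν + α) * (ν + β) / ν * (ν / (ν + α)) * (1 - ν / (ν + β)) ∧
      ν * τ - α * β = (1 - (ν + α) * (ν + β) / ν) * ((ν + α) * (ν + β) / ν) * (ν / (ν + α) * (ν / (ν + β))) := by
  have hνα : 0 < ν + α := by linarith
  have hνβ : 0 < ν + β := by linarith
  refine ⟨by positivity, ?_, by positivity, ?_, by positivity, ?_, ?_, ?_, ?_, ?_⟩
  · rw [div_le_one hνα]; linarith
  · rw [div_le_one hνβ]; linarith
  · rw [div_le_one hν]
    have h1 : (ν + α) * (ν + β) = ν * (ν + α + β) + α * β := by ring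
    have h3 : ν * (ν + α + β) + ν * τ = ν * (τ + α + β + ν) := by ring
    rw [hsum, mul_one] at h3
    rw [h1]; linarith [hH, h3]
  · field_simp
  · field_simp; ring
  · field_simp; ring
  · have hτ : τ = 1 - ν - α - β := by linarith
    rw [hτ]; field_simp; ring

end GZTransferMO

end Summit.CriticalPhenomena.PercolationContinuityZ3.Theorems
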